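import Summits.BirchSwinnertonDyer.BirchSwinnertonDyer.Theorems.ManinLocalTwoThreeNotTrivialEisensteinModThreeInertia
import Summits.BirchSwinnertonDyer.BirchSwinnertonDyer.Theorems.ManinLocalTwoThreeNotTrivialEisensteinModThreeCyclotomic
import Summits.BirchSwinnertonDyer.BirchSwinnertonDyer.Theorems.ManinLocalTwoThreeNotTrivialEisensteinModThreeResidue
import HarnessLib

/-!
# E-es-69♮ at a prime of multiplicative reduction: hNT₃(3) ⟹ hNT₃(q) for `q ≠ 3` multiplicative — ALL `W`

Summit `BirchSwinnertonDyer`, route `ManinLocalTwoThree` (cell bsd-f2-manin), crux C3 `ManinPrimeToThreeAtNine`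
(stmt-BirchSwinnertonDyer-22968).  es's law **E-es-69♮** `KatoCurve.NotTrivialEisensteinModThreeMultiplicative`
(`…ManinAdditive.NotTrivialEisensteinLocalisationThree`; binder `h69n` of es's EDGE 2 `threeAdicUnitWitness_noMuThree_of_laws'`) says:
hNT(3) ⟹ hNT(q) at every `q ∥ N`, `q ≠ 3`.  Here the ARITHMETIC CONTENT is PROVED for every elliptic `W/ℚ`:

* §1 `exists_smul_ne_of_notTrivialEisensteinModThreeAt` — hNT₃(3) supplies `γ₀ ∈ Γ_ℚ` fixed-point-free on `W[3]` (the Frobenius at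
  the witness prime of `notTrivialEisensteinModThreeAt_iff_exists_prime`, read in a frame with `det ρ̄₃ = χ̄₃`; verbatim the
  construction inside `notTrivialEisensteinModThreeAt_of_prime`).
* §2 **`notTrivialEisensteinModThreeAt_of_hasMultiplicativeReductionAt`** — for `W` with multiplicative reduction at the place
  `v ∣ q`, `q ≠ 3` prime: hNT₃(3) ⟹ hNT₃(q).  Proof: were the stabiliser `G₁` of `μ_{q^{M+1}}` free of fixed-point-free elements on
  `W[3]`, write `γ₀ = τ σ₁` with `τ` in the inertia group `I_𝔓` (`𝔓 ∣ q`) acting on `μ_{q^{M+1}}` as `γ₀`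
  (`exists_mem_inertia_smul_eq_of_pow_eq_one`: `ℚ(μ_{q^{M+1}})` is totally ramified at `q`) and `σ₁ ∈ G₁`; the image of `I_𝔓` in
  `Aut(W[3])` has order dividing `3` (Tate curve: tree `natCard_map_inertia_galoisRepTorsion_dvd`), so `u = ρ̄(τ)` is `1` or a
  transvection; the trichotomy `stabiliser_image_trichotomy` for `N = ρ̄(G₁)` then forces a fixed vector of `ρ̄(γ₀) = u·ρ̄(σ₁)`:
  (a) `u` fixes the `Γ`-stable centre `v₀` and `ρ̄(σ₁)v₀ = ±v₀` (sign `−` gives determinant `−1` with eigenvalue `−1`, hence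
  eigenvalue `1`); (b) `u` commutes with the central reflection, so `u = 1`; (c) `ρ̄(σ₁) = 1`.  Then the engine
  `exists_prime_modEq_one_not_three_dvd_of_smul_ne_of_fixed`.  General `W` via a global minimal model
  (`notTrivialEisensteinModThreeAt_of_hasMultiplicativeReductionAt'`).
* §3 **`notTrivialEisensteinModThreeMultiplicative_of_level_eq_conductorNorm`** — es's law VERBATIM, modulo the named fact
  `IsNewformOf.level_eq_conductorNorm` (Carayol: the level of the newform is the conductor, so `q ∥ N` means multiplicative
  reduction at `q`; tree `conductorExponent_eq_one_iff_holds`).  The tree proves `p ∣ N ⟺ p ∣ N_W` unconditionally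
  (`IsNewformOf.dvd_level_iff_dvd_conductorNorm`) but not `v_p(N) = f_p`, hence the named-fact hypothesis.

Axioms standard; no definitions; nothing about BSD, Manin's conjecture, C2/C3 or E-es-69 is proved (E-es-69♮ is now a theorem
modulo Carayol's `N = N_W`).  References: J. Tate, *Global class field theory* (1967) §2.4; J.-P. Serre, Invent. Math. 15 (1972) §5.2;
J. H. Silverman, *ATAEC* V.4–V.5, Ex. 5.13(b); L. Washington, *Cyclotomic Fields*, Prop. 2.3; H. Carayol, Ann. Sci. ÉNS 19 (1986);
HOME/MEMO-es.md §32 (E-es-69♮).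
-/

set_option autoImplicit false
set_option linter.dupNamespace false

noncomputable section

open scoped Classical Matrix MatrixGroups ModularForm

open NumberField IsDedekindDomain Field WeierstrassCurve CongruenceSubgroup
  Literature.NumberTheory.EllipticCurves Literature.NumberTheory.EllipticCurves.ModularForms
  Literature.NumberTheory.GaloisRepresentations
  Summit.BirchSwinnertonDyer.Rank1Residual.ManinAdditive
  Summit.BirchSwinnertonDyer.Rank1Residual.ManinAdditive.KatoCurve

namespace Summit.BirchSwinnertonDyer.BirchSwinnertonDyer.Theorems.ManinLocalTwoThree

/-! ### §1  hNT₃(3) gives a fixed-point-free element on `W[3]` -/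

/-- The units of `𝔽₃` are `±1`. [folklore] -/
private theorem units_zmod_three'' (u : (ZMod 3)ˣ) : u = 1 ∨ u = -1 := by
  fin_cases u <;> decide

/-- The rational prime below a finite place `v` of `ℚ` lies in `v`. [folklore] -/
private theorem natCast_primesEquiv_mem_asIdeal'' (v : HeightOneSpectrum (𝓞 ℚ)) :
    (((Rat.HeightOneSpectrum.primesEquiv v : Nat.Primes) : ℕ) : 𝓞 ℚ) ∈ v.asIdeal := by
  have h := (Rat.HeightOneSpectrum.natGenerator_dvd_iff v).mp dvd_rfl
  rwa [← map_natCast (Rat.IsIntegralClosure.intEquiv (𝓞 ℚ)), Ideal.apply_mem_of_equiv_iff] at h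

/-- **hNT₃(3) ⟹ some `γ₀ ∈ Γ_ℚ` is fixed-point-free on `W[3]`** (globally minimal model): the arithmetic Frobenius at the witness
prime `ℓ` of `notTrivialEisensteinModThreeAt_iff_exists_prime` has `tr = a_ℓ ≢ 1 + ℓ = 1 + det (mod 3)` in a frame with
`det ρ̄₃ = χ̄₃`, hence no eigenvalue `1` (`mulVec_ne_of_trace_ne_one_add_det`).  Verbatim the construction inside
`notTrivialEisensteinModThreeAt_of_prime`. [cite: Serre1981, §8.1 eq. (238) (p. 188)] [cite: Serre1972, §5.2 (iii)] -/
theorem exists_smul_ne_of_notTrivialEisensteinModThreeAt (W : WeierstrassCurve ℚ) [W.IsElliptic] [W.IsGloballyMinimal]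
    (h : NotTrivialEisensteinModThreeAt W 3) :
    ∃ γ₀ : absoluteGaloisGroup ℚ, ∀ P : W.geomTorsion ((3 : ℕ) : ℤ), P ≠ 0 → γ₀ • P ≠ P := by
  classical
  obtain ⟨ℓ, hℓF, hℓ3, hgood, ha⟩ := (notTrivialEisensteinModThreeAt_iff_exists_prime W).mp h
  haveI := hℓF
  have hℓ : ℓ.Prime := Fact.out
  haveI : Fact (Nat.Prime 3) := ⟨Nat.prime_three⟩
  haveI : NeZero ((3 : ℕ) : ℚ) := ⟨by norm_num⟩
  set v : HeightOneSpectrum (𝓞 ℚ) := (Rat.HeightOneSpectrum.primesEquiv (R := 𝓞 ℚ)).symm ⟨ℓ, hℓ⟩ with hvdef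
  have hvℓ : ((Rat.HeightOneSpectrum.primesEquiv v : Nat.Primes) : ℕ) = ℓ := by
    rw [hvdef, Equiv.apply_symm_apply]
  have hv : (ℓ : 𝓞 ℚ) ∈ v.asIdeal := by
    have h := natCast_primesEquiv_mem_asIdeal'' v
    rwa [hvℓ] at h
  obtain ⟨𝔓, h𝔓⟩ := HeightOneSpectrum.primesAbove_nonempty v
  obtain ⟨φ, hφ⟩ := HeightOneSpectrum.exists_isArithFrobAt_of_mem_primesAbove_holds h𝔓
  obtain ⟨e, Φ, hframe, htrace, hdet, -, -⟩ := exists_frame_galoisRepTorsion_rat W 3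
  set A : Matrix (Fin 2) (Fin 2) (ZMod 3) := ((Φ (galoisRepTorsion W ((3 : ℕ) : ℤ) φ) : GL (Fin 2) (ZMod 3)) :
    Matrix (Fin 2) (Fin 2) (ZMod 3)) with hAdef
  have htrA : A.trace = ((W.LFunction ℓ : ℤ) : ZMod 3) := by
    rw [hAdef, htrace, W.trace_galoisRepTorsion_frobenius_eq 3 hℓ3 hgood hvℓ h𝔓 hφ,
      ← W.LFunction_apply_prime_eq_frobeniusTrace ℓ hgood]
  obtain ⟨ζ₃, hζ₃⟩ := HasEnoughRootsOfUnity.prim (M := AlgebraicClosure ℚ) (n := 3)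
  have hζ₃pow : ζ₃ ^ 3 ^ 1 = 1 := by rw [pow_one]; exact hζ₃.pow_eq_one
  have hne : ζ₃ ≠ 0 := hζ₃.ne_zero (by norm_num)
  have hφζ : φ • ζ₃ = ζ₃ ^ ℓ := frob_smul_eq_pow_of_pow_eq_one_prime (k := 1) hℓ Nat.prime_three hℓ3 hv h𝔓 hφ hζ₃pow
  have hspec := modPCyclotomicCharacterZMod_spec ℚ 3 φ ζ₃ hζ₃.pow_eq_one
  rw [hφζ] at hspec
  have hmod3 : ℓ % 3 = 1 ∨ ℓ % 3 = 2 := by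
    have h0 : ℓ % 3 ≠ 0 := fun h0 ↦ by
      have h3 : 3 ∣ ℓ := Nat.dvd_of_mod_eq_zero h0
      exact hℓ3 ((Nat.prime_dvd_prime_iff_eq Nat.prime_three hℓ).mp h3).symm
    omega
  have hdetA : A.det = (ℓ : ZMod 3) := by
    rw [hAdef, ← Matrix.GeneralLinearGroup.val_det_apply, hdet]
    have hℓcast : (ℓ : ZMod 3) = ((ℓ % 3 : ℕ) : ZMod 3) := by rw [ZMod.natCast_mod]
    rcases units_zmod_three'' (modPCyclotomicCharacterZMod ℚ 3 φ) with h1 | hm1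
    · rw [h1, Units.val_one, ZMod.val_one, pow_one] at hspec
      rcases hmod3 with hl | hl
      · rw [h1, Units.val_one, hℓcast, hl]; rfl
      · exfalso
        obtain ⟨c, hc⟩ : ∃ c, ℓ = 3 * c + 2 := ⟨ℓ / 3, by omega⟩
        rw [hc, pow_add, pow_mul, hζ₃.pow_eq_one, one_pow, one_mul] at hspec
        have h1' : ζ₃ = 1 := by
          have : ζ₃ * ζ₃ = ζ₃ * 1 := by rw [mul_one, ← pow_two]; exact hspec
          exact mul_left_cancel₀ hne this
        exact hζ₃.ne_one (by norm_num) h1'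
    · have hval : (-1 : ZMod 3).val = 2 := rfl
      rw [hm1, Units.val_neg, Units.val_one, hval] at hspec
      rcases hmod3 with hl | hl
      · exfalso
        obtain ⟨c, hc⟩ : ∃ c, ℓ = 3 * c + 1 := ⟨ℓ / 3, by omega⟩
        rw [hc, pow_add, pow_mul, hζ₃.pow_eq_one, one_pow, one_mul, pow_one] at hspec
        have h1' : ζ₃ = 1 := by
          have : ζ₃ * ζ₃ = ζ₃ * 1 := by rw [mul_one, ← pow_two]; exact hspec.symm
          exact mul_left_cancel₀ hne this
        exact hζ₃.ne_one (by norm_num) h1'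
      · rw [hm1, Units.val_neg, Units.val_one, hℓcast, hl]; rfl
  have hA := mulVec_ne_of_trace_ne_one_add_det A (by rw [htrA, hdetA, add_comm]; exact ha)
  refine ⟨φ, fun P hP h ↦ ?_⟩
  have hvne : e P ≠ 0 := fun h0 ↦ hP (e.injective (by simpa using h0))
  refine hA (e P) hvne ?_
  have h' := hframe (galoisRepTorsion W ((3 : ℕ) : ℤ) φ) P
  rw [galoisRepTorsion_apply, h] at h'
  exact h'.symm

/-! ### §2  hNT₃(3) ⟹ hNT₃(q) at a prime `q ≠ 3` of multiplicative reduction -/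

/-- **E-es-69♮ at a place of multiplicative reduction, globally minimal model**: for `W/ℚ` globally minimal with multiplicative
reduction at the place `v ∣ q` (`q ≠ 3` prime), `NotTrivialEisensteinModThreeAt W 3 → NotTrivialEisensteinModThreeAt W q`.  See the
module docstring (§2) for the proof. [cite: SilvermanATAEC1994, V.4–V.5 and Exercise 5.13 (b)] [cite: Washington1997, Prop. 2.3]
[cite: TateGCFT1967, §2.4 (Tchebotarev density theorem)] -/
theorem notTrivialEisensteinModThreeAt_of_hasMultiplicativeReductionAt (W : WeierstrassCurve ℚ) [W.IsElliptic]
    [W.IsGloballyMinimal] (h3 : NotTrivialEisensteinModThreeAt W 3) {q : ℕ} (hq : q.Prime) (hq3 : q ≠ 3)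
    (v : HeightOneSpectrum (𝓞 ℚ)) (hv : ((q : ℕ) : 𝓞 ℚ) ∈ v.asIdeal) (hmult : W.HasMultiplicativeReductionAt v) :
    NotTrivialEisensteinModThreeAt W q := by
  classical
  haveI : Fact (Nat.Prime 3) := ⟨Nat.prime_three⟩
  -- reduce to: for every `M`, a fixed-point-free element fixing `μ_{q^{M+1}}`
  suffices key : ∀ M : ℕ, ∃ τ : absoluteGaloisGroup ℚ,
      (∀ ζ : AlgebraicClosure ℚ, ζ ^ q ^ (M + 1) = 1 → τ • ζ = ζ) ∧
        ∀ P : W.geomTorsion ((3 : ℕ) : ℤ), P ≠ 0 → τ • P ≠ P by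
    intro S M
    obtain ⟨τ, hfix, hτ⟩ := key M
    obtain ⟨r, hr, hrS, _, hmod, hgood, hndvd⟩ :=
      exists_prime_modEq_one_not_three_dvd_of_smul_ne_of_fixed W hq M τ hτ hfix S
    refine ⟨r, hr.out, hrS, ?_, ?_⟩
    · rw [pow_succ'] at hmod
      exact Nat.ModEq.of_mul_left q hmod
    · rw [WeierstrassCurve.LFunction_apply_prime_eq_frobeniusTrace W r hgood]
      intro heq
      apply hndvd
      have h3' : ((((r : ℤ) + 1 : ℤ)) : ZMod 3) = ((W.frobeniusTrace r : ℤ) : ZMod 3) := by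
        rw [heq]; push_cast; ring
      have h3'' := (ZMod.intCast_eq_intCast_iff_dvd_sub ((r : ℤ) + 1) (W.frobeniusTrace r) 3).mp h3'
      exact (dvd_frobeniusTrace_sub_iff W 3 r).mp (by exact_mod_cast h3'')
  intro M
  by_contra hcon
  push Not at hcon
  -- the stabiliser predicate
  have hFmul : ∀ σ τ : absoluteGaloisGroup ℚ, (∀ ζ : AlgebraicClosure ℚ, ζ ^ q ^ (M + 1) = 1 → σ • ζ = ζ) →
      (∀ ζ : AlgebraicClosure ℚ, ζ ^ q ^ (M + 1) = 1 → τ • ζ = ζ) →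
      ∀ ζ : AlgebraicClosure ℚ, ζ ^ q ^ (M + 1) = 1 → (σ * τ) • ζ = ζ :=
    fun σ τ hσ hτ ζ hζ ↦ by rw [mul_smul, hτ ζ hζ, hσ ζ hζ]
  have hFconj : ∀ g σ : absoluteGaloisGroup ℚ, (∀ ζ : AlgebraicClosure ℚ, ζ ^ q ^ (M + 1) = 1 → σ • ζ = ζ) →
      ∀ ζ : AlgebraicClosure ℚ, ζ ^ q ^ (M + 1) = 1 → (g * σ * g⁻¹) • ζ = ζ := by
    intro g σ hσ ζ hζ
    have h1 : (g⁻¹ • ζ) ^ q ^ (M + 1) = 1 := by rw [← smul_pow', hζ, smul_one]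
    rw [mul_smul, mul_smul, hσ _ h1, smul_inv_smul]
  -- a frame
  obtain ⟨e, Φ, hframe, -, -, -⟩ := exists_frame_galoisRepTorsion_rat W 3
  set ρ : absoluteGaloisGroup ℚ →* GL (Fin 2) (ZMod 3) :=
    Φ.toMonoidHom.comp (galoisRepTorsion W ((3 : ℕ) : ℤ)) with hρdef
  set A : absoluteGaloisGroup ℚ → Matrix (Fin 2) (Fin 2) (ZMod 3) :=
    fun σ ↦ ((ρ σ : GL (Fin 2) (ZMod 3)) : Matrix (Fin 2) (Fin 2) (ZMod 3)) with hAdef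
  have hAe : ∀ (σ : absoluteGaloisGroup ℚ) (P : W.geomTorsion ((3 : ℕ) : ℤ)), e (σ • P) = A σ *ᵥ e P := by
    intro σ P
    have h := hframe (galoisRepTorsion W ((3 : ℕ) : ℤ) σ) P
    rwa [galoisRepTorsion_apply] at h
  have hAmul : ∀ σ τ : absoluteGaloisGroup ℚ, A (σ * τ) = A σ * A τ := fun σ τ ↦ by
    simp only [hAdef, map_mul, Units.val_mul]
  have hAone : A 1 = 1 := by simp only [hAdef, map_one, Units.val_one]
  have hN : ∀ σ : absoluteGaloisGroup ℚ, (∀ ζ : AlgebraicClosure ℚ, ζ ^ q ^ (M + 1) = 1 → σ • ζ = ζ) →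
      ∃ w : Fin 2 → ZMod 3, w ≠ 0 ∧ A σ *ᵥ w = w := by
    intro σ hσ
    obtain ⟨P, hP0, hP⟩ := hcon σ hσ
    exact ⟨e P, fun h ↦ hP0 (e.injective (by rw [h, map_zero])), by rw [← hAe, hP]⟩
  -- the fixed-point-free element `γ₀`
  obtain ⟨γ₀, hγ₀⟩ := exists_smul_ne_of_notTrivialEisensteinModThreeAt W h3
  have hγ₀A : ∀ w : Fin 2 → ZMod 3, w ≠ 0 → A γ₀ *ᵥ w ≠ w := by
    intro w hw h
    have hP : e.symm w ≠ 0 := fun h0 ↦ hw (by simpa using congrArg e h0)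
    refine hγ₀ (e.symm w) hP (e.injective ?_)
    rw [hAe, e.apply_symm_apply, h]
  -- inertia at `q`: `τ ∈ I_𝔓` acting on `μ_{q^{M+1}}` as `γ₀`, and `ρ̄(τ)³ = 1`
  obtain ⟨𝔓, h𝔓⟩ := HeightOneSpectrum.primesAbove_nonempty v
  obtain ⟨τ, hτI, hτζ⟩ := exists_mem_inertia_smul_eq_of_pow_eq_one hq M v hv h𝔓 γ₀
  have h3v : ((3 : ℕ) : 𝓞 ℚ) ∉ v.asIdeal := by
    intro h3
    have hcop : Nat.Coprime 3 q := (Nat.coprime_primes Nat.prime_three hq).mpr (Ne.symm hq3)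
    obtain ⟨a, b, hab⟩ : ∃ a b : ℤ, a * 3 + b * q = 1 := by
      refine ⟨Nat.gcdA 3 q, Nat.gcdB 3 q, ?_⟩
      have := Nat.gcd_eq_gcd_ab 3 q
      rw [Nat.Coprime.gcd_eq_one hcop] at this; push_cast at this; linarith
    have h1 : (1 : 𝓞 ℚ) ∈ v.asIdeal := by
      have h : ((a * 3 + b * q : ℤ) : 𝓞 ℚ) = 1 := by rw [hab]; simp
      rw [← h]; push_cast
      exact v.asIdeal.add_mem (v.asIdeal.mul_mem_left _ (by exact_mod_cast h3))
        (v.asIdeal.mul_mem_left _ (by exact_mod_cast hv))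
    exact v.isPrime.ne_top ((Ideal.eq_top_iff_one _).mpr h1)
  have hcard := W.natCard_map_inertia_galoisRepTorsion_dvd (n := 3) hmult h3v h𝔓
  have hx3 : (galoisRepTorsion W ((3 : ℕ) : ℤ) τ) ^ 3 = 1 := by
    have hmem : galoisRepTorsion W ((3 : ℕ) : ℤ) τ ∈
        (𝔓.inertia (absoluteGaloisGroup ℚ)).map (W.galoisRepTorsion ((3 : ℕ) : ℤ)) := ⟨τ, hτI, rfl⟩
    have hord := (Subgroup.orderOf_dvd_natCard _ hmem).trans hcard
    exact orderOf_dvd_iff_pow_eq_one.mp hord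
  have hτ3 : A τ * A τ * A τ = 1 := by
    have h1 : ρ τ ^ 3 = 1 := by
      rw [hρdef, MonoidHom.comp_apply, MulEquiv.coe_toMonoidHom, ← map_pow, hx3, map_one]
    have h2 := congrArg (fun g : GL (Fin 2) (ZMod 3) ↦ (g : Matrix (Fin 2) (Fin 2) (ZMod 3))) h1
    simp only [pow_succ, pow_zero, one_mul, Units.val_mul, Units.val_one] at h2
    simpa only [hAdef, mul_assoc] using h2
  -- `σ₁ := τ⁻¹ γ₀` fixes `μ_{q^{M+1}}`, and `A γ₀ = A τ · A σ₁`
  have hσ₁ : ∀ ζ : AlgebraicClosure ℚ, ζ ^ q ^ (M + 1) = 1 → (τ⁻¹ * γ₀) • ζ = ζ :=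
    fun ζ hζ ↦ by rw [mul_smul, ← hτζ ζ hζ, inv_smul_smul]
  have hdec : A γ₀ = A τ * A (τ⁻¹ * γ₀) := by rw [← hAmul, mul_inv_cancel_left]
  obtain ⟨hdetτ, -⟩ := exists_mulVec_eq_of_cube_eq_one (A τ) hτ3
  rcases stabiliser_image_trichotomy (fun σ : absoluteGaloisGroup ℚ ↦
      ∀ ζ : AlgebraicClosure ℚ, ζ ^ q ^ (M + 1) = 1 → σ • ζ = ζ) hFmul hFconj A hAmul hAone hN with
    ⟨σ₀, v₀, -, hu3, -, hv₀, -, hline⟩ | ⟨hnoT, σ₁, v₁, hσ₁F, hs2, hsdet, hv₁, hsv₁, hcomm⟩ | htriv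
  · -- (a) the `Γ`-stable centre `v₀`
    have huv : A τ *ᵥ v₀ = v₀ := by
      rcases hline τ with h | h
      · exact h
      · exact (hv₀ (eq_zero_of_cube_eq_one_of_mulVec_eq_two_smul _ _ hτ3 h)).elim
    rcases hline (τ⁻¹ * γ₀) with h | h
    · exact hγ₀A v₀ hv₀ (by rw [hdec, ← Matrix.mulVec_mulVec, h, huv])
    · have h2 : A γ₀ *ᵥ v₀ = 2 • v₀ := by
        rw [hdec, ← Matrix.mulVec_mulVec, h, Matrix.mulVec_smul, huv]
      -- `A σ₁` is a reflection: it is not `1`, not a transvection (eigenvalue `−1`)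
      obtain ⟨w, hw0, hw⟩ := hN _ hσ₁
      have hdet1 : (A (τ⁻¹ * γ₀)).det = -1 := by
        have hd0 : (A (τ⁻¹ * γ₀)).det ≠ 0 := by
          intro h0
          have h1 := congrArg Matrix.det (hAmul (τ⁻¹ * γ₀)⁻¹ (τ⁻¹ * γ₀))
          rw [inv_mul_cancel, hAone, Matrix.det_one, Matrix.det_mul, h0, mul_zero] at h1
          exact zero_ne_one h1.symm
        rcases eq_one_or_transvection_or_reflection_of_mulVec_eq (A (τ⁻¹ * γ₀)) w hd0 hw0 hw with
          h1 | ⟨h3', -⟩ | ⟨-, hd⟩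
        · exfalso; rw [h1, Matrix.one_mulVec] at h
          exact hv₀ (eq_zero_of_cube_eq_one_of_mulVec_eq_two_smul 1 v₀ (by simp) (by simpa using h))
        · exfalso; exact hv₀ (eq_zero_of_cube_eq_one_of_mulVec_eq_two_smul _ _ h3' h)
        · exact hd
      have hdetγ : (A γ₀).det = -1 := by rw [hdec, Matrix.det_mul, hdetτ, hdet1, one_mul]
      obtain ⟨w', hw'0, hw'⟩ := exists_mulVec_eq_of_det_eq_neg_one_of_mulVec_eq_two_smul (A γ₀) v₀ hdetγ hv₀ h2
      exact hγ₀A w' hw'0 hw'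
  · -- (b) a central reflection: `A τ` commutes with it, so `A τ = 1`
    have hτ1 : A τ = 1 := eq_one_of_cube_eq_one_of_commute_reflection (A τ) (A σ₁) hτ3 hs2 hsdet (hcomm τ)
    obtain ⟨w, hw0, hw⟩ := hN _ hσ₁
    exact hγ₀A w hw0 (by rw [hdec, hτ1, one_mul, hw])
  · -- (c) `A σ₁ = 1`
    obtain ⟨-, w, hw0, hw⟩ := exists_mulVec_eq_of_cube_eq_one (A τ) hτ3
    exact hγ₀A w hw0 (by rw [hdec, htriv _ hσ₁, mul_one, hw])

/-- **E-es-69♮ at a place of multiplicative reduction, any model**: for an elliptic `W/ℚ` with multiplicative reduction at the place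
`v ∣ q` of `𝓞 ℚ` (`q ≠ 3` prime), hNT₃(3) ⟹ hNT₃(q).  (Global minimal model: `hasGlobalMinimalModel_rat_holds`, `LFunction_smul`,
`hasMultiplicativeReductionAt_smul_iff_holds`.) [cite: SilvermanATAEC1994, V.4–V.5 and Exercise 5.13 (b)] [cite: Washington1997, Prop. 2.3] -/
theorem notTrivialEisensteinModThreeAt_of_hasMultiplicativeReductionAt' (W : WeierstrassCurve ℚ) [W.IsElliptic]
    (h3 : NotTrivialEisensteinModThreeAt W 3) {q : ℕ} (hq : q.Prime) (hq3 : q ≠ 3)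
    (v : HeightOneSpectrum (𝓞 ℚ)) (hv : ((q : ℕ) : 𝓞 ℚ) ∈ v.asIdeal) (hmult : W.HasMultiplicativeReductionAt v) :
    NotTrivialEisensteinModThreeAt W q := by
  classical
  obtain ⟨C, hC⟩ := WeierstrassCurve.hasGlobalMinimalModel_rat_holds W
  haveI := hC
  have hmult' : (C • W).HasMultiplicativeReductionAt v :=
    (WeierstrassCurve.hasMultiplicativeReductionAt_smul_iff_holds v W C).mpr hmult
  have h3' : NotTrivialEisensteinModThreeAt (C • W) 3 := by
    intro S M
    obtain ⟨r, hr, hrS, hmod, hne⟩ := h3 S M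
    exact ⟨r, hr, hrS, hmod, by rwa [WeierstrassCurve.LFunction_smul W C]⟩
  intro S M
  obtain ⟨r, hr, hrS, hmod, hne⟩ :=
    notTrivialEisensteinModThreeAt_of_hasMultiplicativeReductionAt (C • W) h3' hq hq3 v hv hmult' S M
  exact ⟨r, hr, hrS, hmod, by rwa [WeierstrassCurve.LFunction_smul W C] at hne⟩

/-! ### §3  es's law E-es-69♮, modulo `N = N_W` (Carayol) -/

/-- **E-es-69♮ `NotTrivialEisensteinModThreeMultiplicative` modulo Carayol's `N = N_W`** (named fact
`IsNewformOf.level_eq_conductorNorm`): for the newform `f ∈ S₂(Γ₀(N))` of `W` and a prime `q ∥ N`, `q ≠ 3`, `N = N_W` gives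
`f_q = 1` (`factorization_conductorNorm_holds`), i.e. multiplicative reduction at `q` (`conductorExponent_eq_one_iff_holds`), and §2
applies. [cite: Carayol1986, Théorème (A) (the level of the newform equals the conductor)] [cite: SilvermanATAEC1994, IV.10.2 (b)] -/
theorem notTrivialEisensteinModThreeMultiplicative_of_level_eq_conductorNorm
    (hC : ∀ {N : ℕ} [NeZero N], IsNewformOf.level_eq_conductorNorm (N := N)) :
    NotTrivialEisensteinModThreeMultiplicative := by
  intro W _ N _ f hf h3 q hq hq3 hq2
  classical
  have hqp : q.Prime := Nat.prime_of_mem_primeFactors hq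
  haveI : Fact q.Prime := ⟨hqp⟩
  have hN : N = W.conductorNorm ℤ := hC hf
  -- the place of `ℤ` at `q` has `f_q = 1`
  set vZ : HeightOneSpectrum ℤ := (Rat.HeightOneSpectrum.primesEquiv (R := ℤ)).symm ⟨q, hqp⟩ with hvZ
  have hgen : Rat.HeightOneSpectrum.natGenerator vZ = q :=
    congrArg Subtype.val ((Rat.HeightOneSpectrum.primesEquiv (R := ℤ)).apply_symm_apply ⟨q, hqp⟩)
  have hf1 : W.conductorExponent vZ = 1 := by
    have hfac := W.factorization_conductorNorm_holds vZ
    rw [hgen, ← hN] at hfac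
    rw [← hfac]
    have h1 : 1 ≤ N.factorization q := (hqp.factorization_pos_of_dvd (NeZero.ne N) (Nat.dvd_of_mem_primeFactors hq))
    have h2 : N.factorization q < 2 := by
      by_contra hle
      push Not at hle
      exact hq2 ((hqp.pow_dvd_iff_le_factorization (NeZero.ne N)).mpr hle)
    omega
  have hmultZ : W.HasMultiplicativeReductionAt vZ :=
    (WeierstrassCurve.conductorExponent_eq_one_iff_holds vZ W).mp hf1
  -- transport to the place of `𝓞 ℚ` at `q`
  have hmultP : W.HasMultiplicativeReductionAtPrime q := by
    have h := (hasMultiplicativeReductionAtPrime_primesEquiv_iff_hasMultiplicativeReductionAt W vZ).mpr hmultZ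
    have hq' : (Rat.HeightOneSpectrum.primesEquiv vZ : ℕ) = q := by rw [hvZ, Equiv.apply_symm_apply]
    convert h using 2; exact hq'.symm
  set v : HeightOneSpectrum (𝓞 ℚ) := (Rat.HeightOneSpectrum.primesEquiv (R := 𝓞 ℚ)).symm ⟨q, hqp⟩ with hvdef
  have hvq : ((Rat.HeightOneSpectrum.primesEquiv v : Nat.Primes) : ℕ) = q := by rw [hvdef, Equiv.apply_symm_apply]
  have hv : ((q : ℕ) : 𝓞 ℚ) ∈ v.asIdeal := by
    have h := natCast_primesEquiv_mem_asIdeal'' v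
    rwa [hvq] at h
  have hmult : W.HasMultiplicativeReductionAt v := by
    have h := (hasMultiplicativeReductionAtPrime_iff_hasMultiplicativeReductionAt_ringOfIntegers W v)
    rw [← h]
    convert hmultP using 2
  exact notTrivialEisensteinModThreeAt_of_hasMultiplicativeReductionAt' W h3 hqp hq3 v hv hmult

/-- **es's EDGE 2 with E-es-69♮ discharged modulo Carayol**: the generic cut `ThreeAdicUnitWitnessOfNoRationalThreeTorsionOfNoMuThree`
of E-es-61 from E-es-69 ALONE, given `N = N_W` (`threeAdicUnitWitness_noMuThree_of_h69` of `…NotTrivialEisensteinModThreeResidue` with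
its binder `h69n` supplied by `notTrivialEisensteinModThreeMultiplicative_of_level_eq_conductorNorm`). [cite: Carayol1986, Théorème (A)] -/
theorem threeAdicUnitWitness_noMuThree_of_h69_of_level_eq_conductorNorm (h69 : ThreeAdicWitnessOfNotTrivialEisenstein)
    (hC : ∀ {N : ℕ} [NeZero N], IsNewformOf.level_eq_conductorNorm (N := N)) :
    ThreeAdicUnitWitnessOfNoRationalThreeTorsionOfNoMuThree :=
  threeAdicUnitWitness_noMuThree_of_h69 h69 (notTrivialEisensteinModThreeMultiplicative_of_level_eq_conductorNorm hC)

/-- The same for es's E-es-61 itself (`ThreeAdicUnitWitnessOfNoRationalThreeTorsion`): from E-es-69, E-es-66, E-es-67♯ and `N = N_W`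
(`threeAdicUnitWitnessOfNoRationalThreeTorsion_of_h69_of_residue`). [cite: Carayol1986, Théorème (A)] -/
theorem threeAdicUnitWitnessOfNoRationalThreeTorsion_of_h69_of_level_eq_conductorNorm
    (h69 : ThreeAdicWitnessOfNotTrivialEisenstein)
    (hC : ∀ {N : ℕ} [NeZero N], IsNewformOf.level_eq_conductorNorm (N := N))
    (h66 : ThreeAdicWitnessOfPlusIndexPrimeToThree) (h67s : PlusIndexPrimeToThreeOfMuThreeNoRationalThreeTorsion) :
    ThreeAdicUnitWitnessOfNoRationalThreeTorsion :=
  threeAdicUnitWitnessOfNoRationalThreeTorsion_of_h69_of_residue h69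
    (notTrivialEisensteinModThreeMultiplicative_of_level_eq_conductorNorm hC) h66 h67s

end Summit.BirchSwinnertonDyer.BirchSwinnertonDyer.Theorems.ManinLocalTwoThree

end
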